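import Literature.NumberTheory.LFunctions.WeilMarkovQuadratic
import Literature.NumberTheory.LFunctions.WeilGroundState
import Literature.NumberTheory.LFunctions.WeilWindowSuzukiProofs
import Literature.NumberTheory.LFunctions.WeilWindowSuzukiAsymptoticProofs

/-!
# Toolkit for stub `stub_commutatorBound` (E) of line `cut-dont-squeeze`, crux `WeilWindowFlow.WindowLipschitz`
(item stmt-RiemannHypothesis-1039)

Elementary measure theory used by the commutator bound:

* `stub_commutatorBound_lintegral_correlation`: Tonelli for correlations,
  `∫⁻∫⁻ φ(x) ψ(x + t) dx dt = (∫⁻ φ)(∫⁻ ψ)`;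
* `stub_commutatorBound_setIntegral_norm_le`: the AM–GM layer bound
  `∫_S |u| ≤ (λ |T| + λ⁻¹ ∫_S |u|²)/2` whenever `u` vanishes on `S` off `T`;
* `stub_commutatorBound_volume_real_shell_le`: the two-sided shell `{a − r₂ < |x| ≤ a − r₁}` has
  measure `≤ 2 (r₂ − r₁)⁺`;
* `stub_commutatorBound_rho_le_inv`: `ρ(t) ≤ 1/t` on `(0, 1]` for the archimedean density
  `ρ = weilArchDensity`;
* `stub_commutatorBound_dyadic`: the DYADIC FAR-FIELD POTENTIAL BOUND. If
  `∫_{a−r<|x|} |u|² ≤ K r / log(1/r)` for `0 < r ≤ d₀ ≤ 1/4` (the `L²` edge-mass law), then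
  `∫_{4h ≤ a−|x| < 2^{J+1} h} |u(x)| ρ((a − |x|)/2) dx ≤ 8 (1 + K) √J` whenever `2^{J+1} h ≤ d₀`:
  Cauchy–Schwarz (in AM–GM form) shell by dyadic shell, `ρ(s) ≤ 1/s`, and
  `Σ_j (log(1/(2^{j+1}h)))^{-1/2} ≤ Σ_{k ≤ J} (k log 2)^{-1/2}`-type telescoping via
  `√(J+1) − √J ≥ 1/(2√(J+1))`.

Sources: line card `Lines/cut-dont-squeeze.md` §Stub E (shell bookkeeping); the IMS localisation
error is classical (Cycon–Froese–Kirsch–Simon, *Schrödinger Operators*, Thm. 3.2).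
-/

set_option linter.dupNamespace false

noncomputable section

open MeasureTheory Set Filter
open scoped Topology ENNReal NNReal

namespace Summit.RiemannHypothesis.RiemannHypothesis.Theorems.WeilWindowFlowWindowLipschitz

open Literature.NumberTheory.LFunctions

/-! ## Generic measure theory -/

/-- **Tonelli for correlations**: `∫⁻ ∫⁻ φ(x) ψ(x + t) dx dt = (∫⁻ φ) (∫⁻ ψ)` for measurable
`φ, ψ : ℝ → ℝ≥0∞` (swap the integrals, then translation invariance of Lebesgue measure in `t`). -/
theorem stub_commutatorBound_lintegral_correlation {φ ψ : ℝ → ℝ≥0∞} (hφ : Measurable φ)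
    (hψ : Measurable ψ) :
    ∫⁻ t, ∫⁻ x, φ x * ψ (x + t) = (∫⁻ x, φ x) * ∫⁻ x, ψ x := by
  have hmeas : Measurable (Function.uncurry fun t x : ℝ ↦ φ x * ψ (x + t)) :=
    (hφ.comp measurable_snd).mul (hψ.comp (measurable_snd.add measurable_fst))
  rw [lintegral_lintegral_swap hmeas.aemeasurable]
  have h1 : ∀ x, ∫⁻ t, φ x * ψ (x + t) = φ x * ∫⁻ y, ψ y := fun x ↦ by
    have hm : Measurable fun t ↦ ψ (x + t) := hψ.comp (measurable_const_add x)
    rw [lintegral_const_mul _ hm, lintegral_add_left_eq_self]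
  simp_rw [h1]
  rw [lintegral_mul_const _ hφ]

/-- **AM–GM layer bound.** If `u` vanishes at the points of `S` outside a set `T` of finite
measure, then `∫_S |u| ≤ (λ |T| + λ⁻¹ ∫_S |u|²) / 2` for every `λ > 0` (pointwise
`|u| ≤ (λ 1_T + |u|²/λ)/2`). Optimising `λ` gives Cauchy–Schwarz `∫_S |u| ≤ |T|^{1/2} ‖u‖_{L²(S)}`. -/
theorem stub_commutatorBound_setIntegral_norm_le {u : ℝ → ℂ} {S T : Set ℝ}
    (hS : MeasurableSet S) (hT : MeasurableSet T) (hTfin : volume T ≠ ⊤)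
    (hsub : ∀ x ∈ S, u x ≠ 0 → x ∈ T) (hu2 : IntegrableOn (fun x ↦ ‖u x‖ ^ 2) S) {l : ℝ}
    (hl : 0 < l) :
    ∫ x in S, ‖u x‖ ≤ (l * volume.real T + (∫ x in S, ‖u x‖ ^ 2) / l) / 2 := by
  have hpt : ∀ x ∈ S, ‖u x‖ ≤ (l * T.indicator (fun _ ↦ (1 : ℝ)) x + ‖u x‖ ^ 2 / l) / 2 := by
    intro x hx
    by_cases hux : u x = 0
    · rw [hux, norm_zero]
      have : 0 ≤ T.indicator (fun _ ↦ (1 : ℝ)) x := Set.indicator_nonneg (fun _ _ ↦ zero_le_one) x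
      positivity
    · rw [indicator_of_mem (hsub x hx hux), mul_one]
      have key : (l + ‖u x‖ ^ 2 / l) / 2 - ‖u x‖ = (l - ‖u x‖) ^ 2 / (2 * l) := by
        field_simp
        ring
      have h0 : 0 ≤ (l - ‖u x‖) ^ 2 / (2 * l) := by positivity
      linarith
  have hind : Integrable (T.indicator fun _ ↦ (1 : ℝ)) (volume.restrict S) :=
    ((integrable_indicator_iff hT).2 (integrableOn_const (hs := hTfin))).integrableOn
  have hgi : Integrable (fun x ↦ (l * T.indicator (fun _ ↦ (1 : ℝ)) x + ‖u x‖ ^ 2 / l) / 2)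
      (volume.restrict S) := ((hind.const_mul l).add (hu2.div_const l)).div_const 2
  have hTS : ∫ x in S, T.indicator (fun _ ↦ (1 : ℝ)) x ≤ volume.real T := by
    rw [integral_indicator hT, setIntegral_const, smul_eq_mul, mul_one,
      measureReal_restrict_apply hT]
    exact measureReal_mono inter_subset_left hTfin
  calc ∫ x in S, ‖u x‖
      ≤ ∫ x in S, (l * T.indicator (fun _ ↦ (1 : ℝ)) x + ‖u x‖ ^ 2 / l) / 2 :=
        integral_mono_of_nonneg (Eventually.of_forall fun x ↦ norm_nonneg _) hgi
          ((ae_restrict_iff' hS).2 (Eventually.of_forall hpt))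
    _ = (l * (∫ x in S, T.indicator (fun _ ↦ (1 : ℝ)) x) + (∫ x in S, ‖u x‖ ^ 2) / l) / 2 := by
        rw [integral_div, integral_add (hind.const_mul l) (hu2.div_const l), integral_const_mul,
          integral_div]
    _ ≤ (l * volume.real T + (∫ x in S, ‖u x‖ ^ 2) / l) / 2 := by
        gcongr

/-- The shell `{a − r₂ < |x| ≤ a − r₁}` is measurable. -/
theorem stub_commutatorBound_measurableSet_shell (a r₁ r₂ : ℝ) :
    MeasurableSet {x : ℝ | a - r₂ < |x| ∧ |x| ≤ a - r₁} :=
  (measurableSet_lt measurable_const continuous_abs.measurable).inter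
    (measurableSet_le continuous_abs.measurable measurable_const)

/-- The layer `{a − r < |x|}` is measurable. -/
theorem stub_commutatorBound_measurableSet_layer (a r : ℝ) :
    MeasurableSet {x : ℝ | a - r < |x|} :=
  measurableSet_lt measurable_const continuous_abs.measurable

/-- The two-sided shell `{a − r₂ < |x| ≤ a − r₁}` lies in two intervals of length `(r₂ − r₁)⁺`. -/
theorem stub_commutatorBound_shell_subset (a r₁ r₂ : ℝ) :
    {x : ℝ | a - r₂ < |x| ∧ |x| ≤ a - r₁} ⊆
      Ioc (a - r₂) (a - r₁) ∪ Ico (-(a - r₁)) (-(a - r₂)) := by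
  intro x hx
  obtain ⟨h1, h2⟩ := hx
  rcases le_or_gt 0 x with hx0 | hx0
  · rw [abs_of_nonneg hx0] at h1 h2
    exact Or.inl ⟨h1, h2⟩
  · rw [abs_of_neg hx0] at h1 h2
    exact Or.inr ⟨by linarith, by linarith⟩

/-- The two-sided shell `{a − r₂ < |x| ≤ a − r₁}` has finite measure. -/
theorem stub_commutatorBound_volume_shell_ne_top (a r₁ r₂ : ℝ) :
    volume {x : ℝ | a - r₂ < |x| ∧ |x| ≤ a - r₁} ≠ ⊤ :=
  (measure_ne_top_of_subset (stub_commutatorBound_shell_subset a r₁ r₂)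
    (measure_union_lt_top measure_Ioc_lt_top measure_Ico_lt_top).ne)

/-- The two-sided shell `{a − r₂ < |x| ≤ a − r₁}` has measure `≤ 2 (r₂ − r₁)⁺`. -/
theorem stub_commutatorBound_volume_real_shell_le (a r₁ r₂ : ℝ) :
    volume.real {x : ℝ | a - r₂ < |x| ∧ |x| ≤ a - r₁} ≤ 2 * max (r₂ - r₁) 0 := by
  calc volume.real {x : ℝ | a - r₂ < |x| ∧ |x| ≤ a - r₁}
      ≤ volume.real (Ioc (a - r₂) (a - r₁) ∪ Ico (-(a - r₁)) (-(a - r₂))) :=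
        measureReal_mono (stub_commutatorBound_shell_subset a r₁ r₂)
          (measure_union_lt_top measure_Ioc_lt_top measure_Ico_lt_top).ne
    _ ≤ volume.real (Ioc (a - r₂) (a - r₁)) + volume.real (Ico (-(a - r₁)) (-(a - r₂))) :=
        measureReal_union_le _ _
    _ = 2 * max (r₂ - r₁) 0 := by
        rw [Real.volume_real_Ioc, Real.volume_real_Ico]
        ring_nf

/-! ## The archimedean density -/

/-- `ρ(t) ≤ 1/t` for `0 < t ≤ 1` (`ρ(t) ≤ e^{t/2}/(2t)` and `e^{1/2} < 2`). -/
theorem stub_commutatorBound_rho_le_inv :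
    ∀ {t : ℝ}, 0 < t → t ≤ 1 → weilArchDensity t ≤ 1 / t := by
  intro t ht ht1
  have h2 : Real.exp (t / 2) ≤ Real.exp (1 / 2) := Real.exp_le_exp.2 (by linarith)
  have h3 : Real.exp (1 / 2) < 2 := by
    have h4 : Real.exp (1 / 2) ^ 2 < 2 ^ 2 := by
      have e : Real.exp (1 / 2) ^ 2 = Real.exp 1 := by
        rw [← Real.exp_nat_mul]
        norm_num
      rw [e]
      have := Real.exp_one_lt_d9
      norm_num
      linarith
    exact lt_of_pow_lt_pow_left₀ 2 (by norm_num) h4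
  calc weilArchDensity t ≤ Real.exp (t / 2) / (2 * t) := weilArchDensity_le_exp_half_div ht
    _ ≤ 2 / (2 * t) := by gcongr; linarith
    _ = 1 / t := by field_simp

/-- `√(J+1) − √J ≥ 1/(2√(J+1))` (rationalise). -/
private theorem stub_commutatorBound_sqrt_step (J : ℕ) :
    1 / (2 * Real.sqrt ((J : ℝ) + 1)) ≤ Real.sqrt ((J : ℝ) + 1) - Real.sqrt J := by
  have h1 : 0 < Real.sqrt ((J : ℝ) + 1) := Real.sqrt_pos.2 (by positivity)
  have h0 : 0 ≤ Real.sqrt (J : ℝ) := Real.sqrt_nonneg _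
  have hle : Real.sqrt (J : ℝ) ≤ Real.sqrt ((J : ℝ) + 1) := Real.sqrt_le_sqrt (by linarith)
  have hprod : (Real.sqrt ((J : ℝ) + 1) - Real.sqrt J) * (Real.sqrt ((J : ℝ) + 1) + Real.sqrt J)
      = 1 := by
    have a := Real.mul_self_sqrt (show (0 : ℝ) ≤ (J : ℝ) + 1 by positivity)
    have b := Real.mul_self_sqrt (show (0 : ℝ) ≤ (J : ℝ) by positivity)
    nlinarith
  rw [div_le_iff₀ (by positivity)]
  calc (1 : ℝ) = (Real.sqrt ((J : ℝ) + 1) - Real.sqrt J) *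
        (Real.sqrt ((J : ℝ) + 1) + Real.sqrt J) := hprod.symm
    _ ≤ (Real.sqrt ((J : ℝ) + 1) - Real.sqrt J) * (2 * Real.sqrt ((J : ℝ) + 1)) :=
        mul_le_mul_of_nonneg_left (by linarith) (sub_nonneg.2 hle)

/-- The far-field weight `x ↦ |u(x)| ρ((a − |x|)/2)` is integrable on any measurable set at depth
`a − |x| ≥ c > 0` (there `ρ((a − |x|)/2) ≤ ρ(c/2)`). -/
theorem stub_commutatorBound_integrableOn_phi {u : ℝ → ℂ} (hum : Measurable u) (hui : Integrable u)
    {a c : ℝ} (hc : 0 < c) {S : Set ℝ} (hS : MeasurableSet S) (hSc : ∀ x ∈ S, |x| ≤ a - c) :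
    IntegrableOn (fun x ↦ ‖u x‖ * weilArchDensity ((a - |x|) / 2)) S := by
  refine Integrable.mono' ((hui.norm.mul_const (weilArchDensity (c / 2))).integrableOn) ?_ ?_
  · exact (hum.norm.mul (measurable_weilArchDensity.comp
      ((measurable_const.sub continuous_abs.measurable).div_const 2))).aestronglyMeasurable
  · refine (ae_restrict_iff' hS).2 (Eventually.of_forall fun x hx ↦ ?_)
    have hx2 : c / 2 ≤ (a - |x|) / 2 := by have := hSc x hx; linarith
    have hρ0 : 0 < weilArchDensity ((a - |x|) / 2) := weilArchDensity_pos (by linarith)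
    rw [Real.norm_of_nonneg (mul_nonneg (norm_nonneg _) hρ0.le)]
    exact mul_le_mul_of_nonneg_left
      (weilArchDensity_antitoneOn (mem_Ioi.2 (by positivity)) (mem_Ioi.2 (by linarith)) hx2)
      (norm_nonneg _)

/-! ## The dyadic far-field bound -/

/-- **One dyadic shell.** Under the edge-mass law, on the shell `{4h ≤ a − |x| < 8h}` (measure
`≤ 8h`, where `ρ((a−|x|)/2) ≤ ρ(2h) ≤ 1/(2h)`):
`∫ |u| ρ((a−|x|)/2) ≤ (1/(2h)) · 4h (1 + K) ℓ^{-1/2} = 2(1+K) ℓ^{-1/2}`, `ℓ = log(1/(8h))`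
(AM–GM with `λ = ℓ^{-1/2}`), and `ℓ^{-1/2} ≤ 2 (J+1)^{-1/2} ≤ 4 (√(J+1) − √J)` once `J + 1 ≤ 4ℓ`. -/
private theorem stub_commutatorBound_shell {u : ℝ → ℂ} {a d₀ K h : ℝ}
    (hui : Integrable u) (hu2 : Integrable fun x ↦ ‖u x‖ ^ 2) (hK : 0 ≤ K) (hd₁ : d₀ ≤ 1 / 4)
    (hB : ∀ r, 0 < r → r ≤ d₀ → ∫ x in {x | a - r < |x|}, ‖u x‖ ^ 2 ≤ K * r / Real.log (1 / r))
    (hh : 0 < h) (h8 : 8 * h ≤ d₀) (J : ℕ) (hJ : (J : ℝ) + 1 ≤ 4 * Real.log (1 / (8 * h))) :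
    ∫ x in {x | a - 8 * h < |x| ∧ |x| ≤ a - 4 * h}, ‖u x‖ * weilArchDensity ((a - |x|) / 2) ≤
      8 * (1 + K) * (Real.sqrt ((J : ℝ) + 1) - Real.sqrt J) := by
  set S := {x : ℝ | a - 8 * h < |x| ∧ |x| ≤ a - 4 * h} with hSdef
  have hS : MeasurableSet S := stub_commutatorBound_measurableSet_shell a (4 * h) (8 * h)
  set ℓ := Real.log (1 / (8 * h)) with hℓ
  have h81 : 8 * h ≤ 1 / 4 := h8.trans hd₁
  have hℓpos : 0 < ℓ := Real.log_pos (by rw [lt_div_iff₀ (by positivity)]; linarith)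
  set σ := Real.sqrt ℓ with hσdef
  have hσ : 0 < σ := Real.sqrt_pos.2 hℓpos
  have hσ2 : σ ^ 2 = ℓ := Real.sq_sqrt hℓpos.le
  -- Step 1: `ρ((a - |x|)/2) ≤ 1/(2h)` on the shell
  have hρS : ∀ x ∈ S, weilArchDensity ((a - |x|) / 2) ≤ 1 / (2 * h) := fun x hx ↦ by
    have hx2 : 2 * h ≤ (a - |x|) / 2 := by have := hx.2; linarith
    calc weilArchDensity ((a - |x|) / 2) ≤ weilArchDensity (2 * h) :=
          weilArchDensity_antitoneOn (mem_Ioi.2 (by positivity)) (mem_Ioi.2 (by linarith)) hx2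
      _ ≤ 1 / (2 * h) := stub_commutatorBound_rho_le_inv (by positivity) (by linarith)
  have h1 : ∫ x in S, ‖u x‖ * weilArchDensity ((a - |x|) / 2) ≤
      ∫ x in S, ‖u x‖ * (1 / (2 * h)) := by
    refine integral_mono_of_nonneg ?_ ((hui.norm.mul_const _).integrableOn) ?_
    · exact (ae_restrict_iff' hS).2 (Eventually.of_forall fun x hx ↦ mul_nonneg (norm_nonneg _)
        (weilArchDensity_pos (by have := hx.2; linarith)).le)
    · exact (ae_restrict_iff' hS).2 (Eventually.of_forall fun x hx ↦
        mul_le_mul_of_nonneg_left (hρS x hx) (norm_nonneg _))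
  -- Step 2: AM–GM on the shell with `λ = σ⁻¹`
  have h2 : ∫ x in S, ‖u x‖ ≤ (σ⁻¹ * volume.real S + (∫ x in S, ‖u x‖ ^ 2) / σ⁻¹) / 2 :=
    stub_commutatorBound_setIntegral_norm_le hS hS (stub_commutatorBound_volume_shell_ne_top a _ _)
      (fun x hx _ ↦ hx) hu2.integrableOn (inv_pos.2 hσ)
  have hvol : volume.real S ≤ 8 * h := by
    have := stub_commutatorBound_volume_real_shell_le a (4 * h) (8 * h)
    rw [max_eq_left (by linarith)] at this
    linarith
  have hmass : ∫ x in S, ‖u x‖ ^ 2 ≤ K * (8 * h) / ℓ := by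
    calc ∫ x in S, ‖u x‖ ^ 2 ≤ ∫ x in {x | a - 8 * h < |x|}, ‖u x‖ ^ 2 :=
          setIntegral_mono_set hu2.integrableOn (Eventually.of_forall fun x ↦ by positivity)
            (show S ⊆ {x | a - 8 * h < |x|} from fun x hx ↦ hx.1).eventuallyLE
      _ ≤ K * (8 * h) / ℓ := hB _ (by positivity) h8
  have h3 : ∫ x in S, ‖u x‖ ≤ 4 * h * (1 + K) / σ := by
    calc ∫ x in S, ‖u x‖ ≤ (σ⁻¹ * volume.real S + (∫ x in S, ‖u x‖ ^ 2) / σ⁻¹) / 2 := h2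
      _ ≤ (σ⁻¹ * (8 * h) + (K * (8 * h) / ℓ) / σ⁻¹) / 2 := by gcongr
      _ = 4 * h * (1 + K) / σ := by
          rw [← hσ2]
          field_simp
          ring
  have h4 : ∫ x in S, ‖u x‖ * weilArchDensity ((a - |x|) / 2) ≤ 2 * (1 + K) / σ := by
    calc ∫ x in S, ‖u x‖ * weilArchDensity ((a - |x|) / 2)
        ≤ ∫ x in S, ‖u x‖ * (1 / (2 * h)) := h1
      _ = (∫ x in S, ‖u x‖) * (1 / (2 * h)) := integral_mul_const _ _
      _ ≤ (4 * h * (1 + K) / σ) * (1 / (2 * h)) := by gcongr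
      _ = 2 * (1 + K) / σ := by
          field_simp
          ring
  -- Step 3: `1/σ ≤ 4 (√(J+1) - √J)`
  have hJ1 : 0 < Real.sqrt ((J : ℝ) + 1) := Real.sqrt_pos.2 (by positivity)
  have h5 : 1 / σ ≤ 2 / Real.sqrt ((J : ℝ) + 1) := by
    rw [div_le_div_iff₀ hσ hJ1, one_mul]
    have h4eq : Real.sqrt 4 = 2 := by
      rw [show (4 : ℝ) = 2 ^ 2 by norm_num, Real.sqrt_sq (by norm_num)]
    calc Real.sqrt ((J : ℝ) + 1) ≤ Real.sqrt (4 * ℓ) := Real.sqrt_le_sqrt (by linarith)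
      _ = 2 * σ := by rw [Real.sqrt_mul (by norm_num), h4eq]
  have h6 : 1 / σ ≤ 4 * (Real.sqrt ((J : ℝ) + 1) - Real.sqrt J) := by
    have := stub_commutatorBound_sqrt_step J
    calc 1 / σ ≤ 2 / Real.sqrt ((J : ℝ) + 1) := h5
      _ = 4 * (1 / (2 * Real.sqrt ((J : ℝ) + 1))) := by
          field_simp
          ring
      _ ≤ 4 * (Real.sqrt ((J : ℝ) + 1) - Real.sqrt J) := by gcongr
  calc ∫ x in S, ‖u x‖ * weilArchDensity ((a - |x|) / 2) ≤ 2 * (1 + K) / σ := h4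
    _ = 2 * (1 + K) * (1 / σ) := by ring
    _ ≤ 2 * (1 + K) * (4 * (Real.sqrt ((J : ℝ) + 1) - Real.sqrt J)) := by gcongr
    _ = 8 * (1 + K) * (Real.sqrt ((J : ℝ) + 1) - Real.sqrt J) := by ring

/-- **The dyadic far-field bound.** Under the edge-mass law
`∫_{a−r<|x|} |u|² ≤ K r / log(1/r)` (`0 < r ≤ d₀ ≤ 1/4`), for every `J` and `h > 0` with
`2^{J+2} h ≤ d₀`: `∫_{4h ≤ a−|x| < 2^{J+1}h} |u(x)| ρ((a − |x|)/2) dx ≤ 8 (1 + K) √J`.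
Induction on `J` (doubling `h`): the region for `(J+1, h)` is the region for `(J, 2h)` plus the
shell `{4h ≤ a − |x| < 8h}`, which contributes `≤ 8(1+K)(√(J+1) − √J)` by
`stub_commutatorBound_shell` (`log(1/(8h)) ≥ (J+2) log 2 ≥ (J+1)/4`). This is the
`(log(1/h))^{+1/2}` half of the exact cancellation of half-powers in the commutator bound. -/
theorem stub_commutatorBound_dyadic {u : ℝ → ℂ} {a d₀ K : ℝ} (hum : Measurable u)
    (hui : Integrable u) (hu2 : Integrable fun x ↦ ‖u x‖ ^ 2) (hK : 0 ≤ K) (hd₁ : d₀ ≤ 1 / 4)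
    (hB : ∀ r, 0 < r → r ≤ d₀ → ∫ x in {x | a - r < |x|}, ‖u x‖ ^ 2 ≤ K * r / Real.log (1 / r))
    (J : ℕ) {h : ℝ} (hh : 0 < h) (hJ : 2 ^ (J + 2) * h ≤ d₀) :
    ∫ x in {x | a - 2 ^ (J + 1) * h < |x| ∧ |x| ≤ a - 4 * h},
        ‖u x‖ * weilArchDensity ((a - |x|) / 2) ≤ 8 * (1 + K) * Real.sqrt J := by
  induction J generalizing h with
  | zero =>
    have hempty : {x : ℝ | a - 2 ^ (0 + 1) * h < |x| ∧ |x| ≤ a - 4 * h} = ∅ := by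
      ext x
      simp only [mem_setOf_eq, mem_empty_iff_false, iff_false, not_and, not_le]
      intro hx
      norm_num at hx
      linarith
    rw [hempty, Measure.restrict_empty, integral_zero_measure]
    simp
  | succ J ih =>
    have hJ' : 2 ^ (J + 2) * (2 * h) ≤ d₀ := by
      calc (2 : ℝ) ^ (J + 2) * (2 * h) = 2 ^ (J + 1 + 2) * h := by ring
        _ ≤ d₀ := hJ
    have ih' := ih (by positivity) hJ'
    have hpow : (8 : ℝ) ≤ 2 ^ (J + 1 + 2) := by
      calc (8 : ℝ) = 2 ^ 3 := by norm_num
        _ ≤ 2 ^ (J + 1 + 2) := pow_le_pow_right₀ (by norm_num) (by omega)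
    have h8 : 8 * h ≤ d₀ := le_trans (by nlinarith) hJ
    set R₁ := {x : ℝ | a - 2 ^ (J + 1 + 1) * h < |x| ∧ |x| ≤ a - 4 * h} with hR₁
    set R₀ := {x : ℝ | a - 2 ^ (J + 1) * (2 * h) < |x| ∧ |x| ≤ a - 4 * (2 * h)} with hR₀
    set Sh := {x : ℝ | a - 8 * h < |x| ∧ |x| ≤ a - 4 * h} with hSh
    have hR₀m : MeasurableSet R₀ := stub_commutatorBound_measurableSet_shell a _ _
    have hShm : MeasurableSet Sh := stub_commutatorBound_measurableSet_shell a _ _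
    have hsub : R₁ ⊆ R₀ ∪ Sh := fun x hx ↦ by
      rcases le_or_gt |x| (a - 8 * h) with hx8 | hx8
      · left
        refine ⟨?_, by linarith⟩
        have e : (2 : ℝ) ^ (J + 1) * (2 * h) = 2 ^ (J + 1 + 1) * h := by ring
        rw [e]
        exact hx.1
      · right
        exact ⟨hx8, hx.2⟩
    have hdisj : Disjoint R₀ Sh := disjoint_left.2 fun x hx0 hxs ↦ by
      have := hx0.2
      have := hxs.1
      linarith
    have hint₀ : IntegrableOn (fun x ↦ ‖u x‖ * weilArchDensity ((a - |x|) / 2)) R₀ :=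
      stub_commutatorBound_integrableOn_phi hum hui (by positivity : 0 < 4 * (2 * h)) hR₀m
        (fun x hx ↦ hx.2)
    have hints : IntegrableOn (fun x ↦ ‖u x‖ * weilArchDensity ((a - |x|) / 2)) Sh :=
      stub_commutatorBound_integrableOn_phi hum hui (by positivity : 0 < 4 * h) hShm
        (fun x hx ↦ hx.2)
    have hintU : IntegrableOn (fun x ↦ ‖u x‖ * weilArchDensity ((a - |x|) / 2)) (R₀ ∪ Sh) :=
      hint₀.union hints
    have hnn : 0 ≤ᵐ[volume.restrict (R₀ ∪ Sh)]
        fun x ↦ ‖u x‖ * weilArchDensity ((a - |x|) / 2) := by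
      refine (ae_restrict_iff' (hR₀m.union hShm)).2 (Eventually.of_forall fun x hx ↦ ?_)
      have hx4 : |x| ≤ a - 4 * h := hx.elim (fun h0 ↦ by have := h0.2; linarith) (fun hs ↦ hs.2)
      exact mul_nonneg (norm_nonneg _) (weilArchDensity_pos (by linarith)).le
    -- the logarithmic room: `J + 2 ≤ 4 log(1/(8h))`
    have hlog : (J : ℝ) + 1 ≤ 4 * Real.log (1 / (8 * h)) := by
      have hl2 := Real.log_two_gt_d9
      have hq : (2 : ℝ) ^ (J + 2) ≤ 1 / (8 * h) := by
        rw [le_div_iff₀ (by positivity)]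
        calc (2 : ℝ) ^ (J + 2) * (8 * h) = 2 ^ (J + 1 + 2) * h * 4 := by ring
          _ ≤ d₀ * 4 := by gcongr
          _ ≤ 1 := by linarith
      have hlog2 : ((J + 2 : ℕ) : ℝ) * Real.log 2 ≤ Real.log (1 / (8 * h)) := by
        rw [← Real.log_pow]
        exact Real.log_le_log (by positivity) hq
      push_cast at hlog2 ⊢
      nlinarith
    have hshell := stub_commutatorBound_shell hui hu2 hK hd₁ hB hh h8 J hlog
    calc ∫ x in R₁, ‖u x‖ * weilArchDensity ((a - |x|) / 2)
        ≤ ∫ x in R₀ ∪ Sh, ‖u x‖ * weilArchDensity ((a - |x|) / 2) :=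
          setIntegral_mono_set hintU hnn hsub.eventuallyLE
      _ = (∫ x in R₀, ‖u x‖ * weilArchDensity ((a - |x|) / 2)) +
            ∫ x in Sh, ‖u x‖ * weilArchDensity ((a - |x|) / 2) :=
          setIntegral_union hdisj hShm hint₀ hints
      _ ≤ 8 * (1 + K) * Real.sqrt J +
            8 * (1 + K) * (Real.sqrt ((J : ℝ) + 1) - Real.sqrt (J : ℝ)) :=
          add_le_add ih' hshell
      _ = 8 * (1 + K) * Real.sqrt ((J + 1 : ℕ) : ℝ) := by
          push_cast
          ring

end Summit.RiemannHypothesis.RiemannHypothesis.Theorems.WeilWindowFlowWindowLipschitz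

end
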